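import Summits.BirchSwinnertonDyer.BirchSwinnertonDyer.Theorems.ErratumRoadFiveOpenInputIMCRest3FromPrint
import Summits.BirchSwinnertonDyer.BirchSwinnertonDyer.Theorems.Rank1ResidualIntModelReduction
import Summits.BirchSwinnertonDyer.Rank1Residual.X5.TwoAdicInstancesToolkit
import Literature.NumberTheory.EllipticCurves.Rank1Residual.X9NoEntry
import HarnessLib

/-!
# Route `ErratumRoadFive` (rung K2, `p ≥ 5`), crux `OpenInputIMC` (item stmt-BirchSwinnertonDyer-19061):
# a SECOND BC5 RUNG, OUTSIDE the printed per-curve range — route p2's open input `P2OpenInputOnTreeAt E 5`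
# at the explicit erratum-claimed (ram) pair `E = 5835a1` (`N = 5835 ≥ 5000`), `p = 5`, modulo the ONE
# preprint input H3♭ AT THAT PAIR and PUBLISHED named facts
# (cell `bsd-stepL`, seat `bsd-stepL-imc-p1` g4; `--supports stmt-BirchSwinnertonDyer-19061 --as helper`)

HONEST FRAMING (cell `bsd-stepL`, run/shared/lean/pub/bsd-stepL/, HUMAN RULINGS D-0059 ∕ D-0074):
THEOREMS ONLY (no definition, no named fact, no `sorry`, no `native_decide`; axioms standard); nothing
is booked; BSD is NOT proved by any of this; the rung is ONE curve and closes no item and no census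
class. PARTITION (D-0054): X11b@p≥5 (B9 ∕ N8) × the pair `(5835a1, 5)` (book230 class `5835a`, `r = 1`)
× `p = 5 ∥ N = 5835` — types-the-object-of (an instance of crux 2 = item 19061 on the erratum sub-locus
«odd NON-split `E[p]`-ramified multiplicative `q ≠ p` ∧ `E(ℚ_p)[p] = 0»); closes: none.

WHY A SECOND RUNG (companion of `ErratumRoadFiveOpenInputRung65a1.lean`, same seat, same session). The
first rung `(65a1, 5)` has `N = 65 < 5000`, hence sits inside the PRINTED per-curve verification of BSD
(Miller 2011 Thm. 1.2 ∕ Creutz–Miller 2012: `r_an ≤ 1`, `N < 5000`), from which the open input at that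
pair already follows through the tree's tightness `P2.openInputOnTreeAt_of_bsdp_of_ram` — by the cell's
BC5 doctrine (planner g23, `plan/D0059/BC5-CORRECTION-K2a-g23.md`: «a rung sitting inside S's printed
known regime is not a witness of weakness») the tribunal may prefer a pair OUTSIDE that range. This file
supplies one: `N(5835a1) = 5835 ≥ 5000` is a KERNEL numeral here (`conductorNorm_5835a1`,
`conductorNorm_5835a1_ge`), and at `p ∥ N` no class-wide printed theorem gives `BSD(E, p)` (Castella 2018
Thm. A is withdrawn at `p ∥ N`, its replacement is the erratum = preprint; JSW17 ∕ BCS24 need good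
ordinary `p`; W. Zhang 2014 needs `p ∤ N`; Skinner–Zhang 2014 is a preprint).

THE PAIR. `E = 5835a1`: Cremona `[0, −1, 1, 4, −4]`, `y² + y = x³ − x² + 4x − 4`, `N = 5835 = 3·5·389`,
`Δ = −5835`, `c₄ = −176`, `r_an = 1` (Cremona's table; census `census2_all_500k` row
`5835a1 5 5835 surj 1 nonsplit 1 2 2 2 1 1 0 1 1 1 1 2 1 0 1` — the X11b pair of smallest height among the
semistable surjective rows with `N ≥ 5000`, `p = 5` non-split and an odd non-split witness). KERNEL-DECIDED
here (§§1–2; `decide` ∕ `norm_num` on the literal integer model, through `IntModel.*`,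
`X5.Instances.*`, `LocalTorsion.*`, `surj_of_irr_of_ram`): `Δ ≠ 0`; global minimality
(`gcd(Δ, c₄) = 1`); `N = 5835 ≥ 5000`; `5` NON-split multiplicative (`5 ∣ Δ`, `5 ∤ c₄`, node-tangent
quadratic `−176T² + 538 ≡ 4T² + 3` root-free mod `5`); `3` NON-split multiplicative (`≡ T² + 1` root-free
mod `3`); `v₃(Δ_min) = 1`, so `5 ∤ v₃(Δ_min)`: `E[5]` ramified at `3` = the (ram) witness AND erratum
hypothesis (iii)'s odd non-split witness `q = 3`; erratum hypothesis (iv) `E(ℚ₅)[5] = 0` (non-split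
`5 ≥ 3`); `#Ẽ(𝔽₇) = 4`, `a₇ = 4`, `X² − 4X + 7` root-free mod `5` ⟹ `E[5]` irreducible (Mazur 1978
Prop. 6.3 (1)); hence `ρ̄_{E,5}` ONTO (irr ∧ ram) — the open input at this pair is NOT vacuous. NOT
decided (carried by the `ClassX11b` binder INSIDE the predicate, as in the K2@3 rung
`RegMult.Rung62310y1.rung_62310y1_of_GZK`): `r_an(5835a1) = 1`.

THE RUNG (§3): `openInputOnTreeAt_5835a1_5` — (VN_p) `castella2018Exceptional_bdpValueContinuity_trivialChar`
(PUBLISHED, p434741) + the eleven published ∕ two cited named facts of imc-p1's reduction (= the conjuncts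
of items 19283 and 19285) + the JSW control fact `thm331_anticyclotomicControl_mult` (PUBLISHED) +
**H3♭ AT THIS PAIR** `P2.IMCDivIntCoreFrameAtErratumData E 5` (erratum (2.4) ⇐ [FW21, Thm. 4.41] on the
erratum data of `(5835a1, 5)`; the instance at this pair of the deciding child 19270; PREPRINT, the ONLY
non-published input) ⟹ `P2OpenInputOnTreeAt E 5`. One line from imc-p1 g3's pair-level
`openInputOnTreeAt_of_oddNonsplitRam_of_localTorsion_of_core_of_castella2018Exceptional` (p437572) with
`q = 3`. §4: the same over the route's ITEMS by name (`openInputOnTreeAt_5835a1_5_of_items`: (VN_p) →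
19270 → 19283 → 19285 → JSW fact → open input at the pair) and in closed form
(`openInputOnTreeAt_5835a1_5_closed`).

The curve is written LITERALLY throughout (`(⟨0, −1, 1, 4, −4⟩ : WeierstrassCurve ℤ).baseChange ℚ`; no
abbreviation is declared, so that this file stays a pure-proof file); statements needing `IsElliptic` ∕
`IsGloballyMinimal` take them as instance binders, and both are THEOREMS of §1.

References: [Castella2018Erratum] Thm. 1.1 (i)–(iv), (2.4) (pp. 1, 4); [Castella2024] arXiv:2409.01360
Thm. 3.1; [FouquetWan2021] arXiv:2107.13726 Thm. 4.41; [Castella2018Exceptional] Thms. 2.10–2.11;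
[JetchevSkinnerWan2017] Thm. 3.3.1, §3.5; [Wuthrich2014] Prop. 21; [SilvermanAEC2009] VII.1 Rem. 1.1,
VII.5 Prop. 5.1, VII.6.1; [Silverman1994] IV.10.2; [Mazur1978] Prop. 6.3 (1); [Serre1972] Prop. 15;
[Miller2011LMS] Thm. 1.2, §1; [CreutzMiller2012] Thm. 1.1; [Cremona1997] Table 1 (curve 5835a1).
-/

set_option autoImplicit false
-- the Theorems namespace of this sub repeats the summit name by design (D-0017 nested layout)
set_option linter.dupNamespace false

noncomputable section

open scoped Classical

open WeierstrassCurve IsDedekindDomain NumberField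
  Literature.NumberTheory.EllipticCurves Literature.NumberTheory.EllipticCurves.ModularForms
  Literature.NumberTheory.EllipticCurves.Rank1Residual
  Literature.NumberTheory.EllipticCurves.Rank1Residual.Typed
  Literature.NumberTheory.EllipticCurves.Wuthrich2014
  Literature.NumberTheory.EllipticCurves.Castella2018
  Literature.NumberTheory.EllipticCurves.JetchevSkinnerWan2017
  Literature.NumberTheory.GaloisRepresentations Literature.NumberTheory.GaloisCohomology
  Summit.BirchSwinnertonDyer.Rank1Residual Summit.BirchSwinnertonDyer.Rank1Residual.X11b
  Summit.BirchSwinnertonDyer.BirchSwinnertonDyer.Rank1Residual.IntModel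
  Summit.BirchSwinnertonDyer.BirchSwinnertonDyer.Theses

namespace Summit.BirchSwinnertonDyer.BirchSwinnertonDyer.Theorems

/-! ## §1 The model `5835a1` and its kernel-decided invariants

The curve is written LITERALLY throughout (no abbreviation is declared, so that this file stays a
pure-proof file): `M = ⟨0, −1, 1, 4, −4⟩ : WeierstrassCurve ℤ` (Cremona `5835a1`,
`y² + y = x³ − x² + 4x − 4`) and `E = M ⊗ ℚ`. -/

/-- `Δ(5835a1) = −5835 = −3·5·389`. [cite: Cremona1997, Table 1 (curve 5835a1)] -/
theorem M5835a1_Δ : (⟨0, -1, 1, 4, -4⟩ : WeierstrassCurve ℤ).Δ = -5835 := by decide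

/-- `c₄(5835a1) = −176 = −2⁴·11`. [cite: Cremona1997, Table 1 (curve 5835a1)] -/
theorem M5835a1_c₄ : (⟨0, -1, 1, 4, -4⟩ : WeierstrassCurve ℤ).c₄ = -176 := by decide

/-- `5835a1` is an elliptic curve (`Δ = −5835 ≠ 0`). [cite: SilvermanAEC2009, III.1] -/
theorem isElliptic_5835a1 : ((⟨0, -1, 1, 4, -4⟩ : WeierstrassCurve ℤ).baseChange ℚ).IsElliptic := by
  rw [WeierstrassCurve.isElliptic_iff, baseChange_int_Δ, M5835a1_Δ]; norm_num

/-- Cremona's model `[0, −1, 1, 4, −4]` of `5835a1` is globally minimal (`gcd(Δ, c₄) = gcd(5835, 176) = 1`).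
[cite: SilvermanAEC2009, VII.1 Remark 1.1] -/
theorem isGloballyMinimal_5835a1 :
    ((⟨0, -1, 1, 4, -4⟩ : WeierstrassCurve ℤ).baseChange ℚ).IsGloballyMinimal :=
  X5.Instances.isGloballyMinimal_baseChange_int_of_gcd_eq_one 0 (-1) 1 4 (-4) (by decide)

/-- `Δ(5835a1)` and `c₄(5835a1)` are coprime (a semistable model). [cite: SilvermanAEC2009, VII.5 Prop. 5.1(b)] -/
theorem M5835a1_coprime :
    IsCoprime (⟨0, -1, 1, 4, -4⟩ : WeierstrassCurve ℤ).Δ (⟨0, -1, 1, 4, -4⟩ : WeierstrassCurve ℤ).c₄ := by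
  rw [M5835a1_Δ, M5835a1_c₄, Int.isCoprime_iff_gcd_eq_one]; decide

/-- **`N(5835a1) = 5835 = 3·5·389`** (semistable: `N = rad Δ`). [cite: Silverman1994, IV.10.2 (a),(b)]
[cite: Cremona1997, Table 1 (curve 5835a1)] -/
theorem conductorNorm_5835a1 [((⟨0, -1, 1, 4, -4⟩ : WeierstrassCurve ℤ).baseChange ℚ).IsElliptic] :
    ((⟨0, -1, 1, 4, -4⟩ : WeierstrassCurve ℤ).baseChange ℚ).conductorNorm ℤ = 5835 := by
  refine X5.Instances.conductorNorm_baseChange_int_of_isCoprime (⟨0, -1, 1, 4, -4⟩ : WeierstrassCurve ℤ)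
    M5835a1_coprime (k := 1) ?_ ?_ ?_
  · exact Nat.squarefree_mul_iff.mpr ⟨by norm_num, (show Nat.Prime 3 by norm_num).prime.squarefree,
      Nat.squarefree_mul_iff.mpr ⟨by norm_num, (show Nat.Prime 5 by norm_num).prime.squarefree,
        (show Nat.Prime 389 by norm_num).prime.squarefree⟩⟩
  · rw [M5835a1_Δ]; norm_num
  · rw [M5835a1_Δ]; norm_num

/-- **`N(5835a1) ≥ 5000`**: the pair lies OUTSIDE the printed per-curve verifications of BSD
(Miller 2011 ∕ Creutz–Miller 2012 ∕ Lawson–Wuthrich 2016: `N < 5000`). [cite: Miller2011LMS, Thm. 1.2 and §1] -/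
theorem conductorNorm_5835a1_ge [((⟨0, -1, 1, 4, -4⟩ : WeierstrassCurve ℤ).baseChange ℚ).IsElliptic] :
    5000 ≤ ((⟨0, -1, 1, 4, -4⟩ : WeierstrassCurve ℤ).baseChange ℚ).conductorNorm ℤ := by
  rw [conductorNorm_5835a1]; norm_num

/-! ## §2 Local data at `5` and `3`, the (ram) witness, (iv), `E[5]` irreducible and `ρ̄_{E,5}` onto -/

/-- **Multiplicative reduction at `5`** (`5 ∣ Δ = −5835`, `5 ∤ c₄ = −176`). [cite: SilvermanAEC2009, VII.5 Prop. 5.1(b)] -/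
theorem mult_five_5835a1 [((⟨0, -1, 1, 4, -4⟩ : WeierstrassCurve ℤ).baseChange ℚ).IsElliptic]
    [((⟨0, -1, 1, 4, -4⟩ : WeierstrassCurve ℤ).baseChange ℚ).IsGloballyMinimal] :
    Mult ((⟨0, -1, 1, 4, -4⟩ : WeierstrassCurve ℤ).baseChange ℚ) 5 :=
  hasMultiplicativeReductionAtPrime_of_intModel (integralModelInt_baseChange_int _) 5
    (by rw [M5835a1_Δ]; decide) (by rw [M5835a1_c₄]; decide)

/-- **NON-split multiplicative at `5`**: the node-tangent quadratic `−176T² + 538` of the model is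
root-free mod `5` (`≡ 4T² + 3`). [cite: SilvermanAEC2009, VII.5 Prop. 5.1(b)] -/
theorem not_split_five_5835a1 [((⟨0, -1, 1, 4, -4⟩ : WeierstrassCurve ℤ).baseChange ℚ).IsElliptic]
    [((⟨0, -1, 1, 4, -4⟩ : WeierstrassCurve ℤ).baseChange ℚ).IsGloballyMinimal] :
    ¬ ((⟨0, -1, 1, 4, -4⟩ : WeierstrassCurve ℤ).baseChange ℚ).HasSplitMultiplicativeReductionAtPrime 5 :=
  not_hasSplitMultiplicativeReductionAtPrime_of_intModel_of_noroot (integralModelInt_baseChange_int _) 5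
    (by rw [M5835a1_Δ]; decide) (by rw [M5835a1_c₄]; decide) (by decide)

/-- **Multiplicative reduction at `3`** (`3 ∣ Δ = −5835`, `3 ∤ c₄ = −176`). [cite: SilvermanAEC2009, VII.5 Prop. 5.1(b)] -/
theorem mult_three_5835a1 [((⟨0, -1, 1, 4, -4⟩ : WeierstrassCurve ℤ).baseChange ℚ).IsElliptic]
    [((⟨0, -1, 1, 4, -4⟩ : WeierstrassCurve ℤ).baseChange ℚ).IsGloballyMinimal] :
    Mult ((⟨0, -1, 1, 4, -4⟩ : WeierstrassCurve ℤ).baseChange ℚ) 3 :=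
  hasMultiplicativeReductionAtPrime_of_intModel (integralModelInt_baseChange_int _) 3
    (by rw [M5835a1_Δ]; decide) (by rw [M5835a1_c₄]; decide)

/-- **NON-split multiplicative at `3`**: the node-tangent quadratic `−176T² + 538 ≡ T² + 1` is
root-free mod `3`. [cite: SilvermanAEC2009, VII.5 Prop. 5.1(b)] -/
theorem not_split_three_5835a1 [((⟨0, -1, 1, 4, -4⟩ : WeierstrassCurve ℤ).baseChange ℚ).IsElliptic]
    [((⟨0, -1, 1, 4, -4⟩ : WeierstrassCurve ℤ).baseChange ℚ).IsGloballyMinimal] :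
    ¬ ((⟨0, -1, 1, 4, -4⟩ : WeierstrassCurve ℤ).baseChange ℚ).HasSplitMultiplicativeReductionAtPrime 3 :=
  not_hasSplitMultiplicativeReductionAtPrime_of_intModel_of_noroot (integralModelInt_baseChange_int _) 3
    (by rw [M5835a1_Δ]; decide) (by rw [M5835a1_c₄]; decide) (by decide)

/-- `v₃(Δ_min(5835a1)) = 1` — so `5 ∤ v₃(Δ_min)`: `E[5]` is ramified at `3` (Tate).
[cite: SilvermanAEC2009, VII.5 Prop. 5.1(b)] -/
theorem padicValInt_three_minimalDiscriminant_5835a1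
    [((⟨0, -1, 1, 4, -4⟩ : WeierstrassCurve ℤ).baseChange ℚ).IsGloballyMinimal] :
    padicValInt 3 ((⟨0, -1, 1, 4, -4⟩ : WeierstrassCurve ℤ).baseChange ℚ).minimalDiscriminantInt = 1 := by
  rw [minimalDiscriminantInt_baseChange_int, M5835a1_Δ]
  exact padicValInt_eq_of_dvd_of_not_dvd 3 (by decide) (by decide)

/-- `v₅(Δ_min(5835a1)) = 1`. [cite: SilvermanAEC2009, VII.5 Prop. 5.1(b)] -/
theorem padicValInt_five_minimalDiscriminant_5835a1
    [((⟨0, -1, 1, 4, -4⟩ : WeierstrassCurve ℤ).baseChange ℚ).IsGloballyMinimal] :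
    padicValInt 5 ((⟨0, -1, 1, 4, -4⟩ : WeierstrassCurve ℤ).baseChange ℚ).minimalDiscriminantInt = 1 := by
  rw [minimalDiscriminantInt_baseChange_int, M5835a1_Δ]
  exact padicValInt_eq_of_dvd_of_not_dvd 5 (by decide) (by decide)

/-- **The (ram) witness at `p = 5`**: `3 ≠ 5` is multiplicative with `5 ∤ v₃(Δ_min) = 1`
(`Rank1Residual.Ram`). [cite: SkinnerUrban2014, Thm. 2 (p. 3), second bullet] -/
theorem ram_five_5835a1 [((⟨0, -1, 1, 4, -4⟩ : WeierstrassCurve ℤ).baseChange ℚ).IsElliptic]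
    [((⟨0, -1, 1, 4, -4⟩ : WeierstrassCurve ℤ).baseChange ℚ).IsGloballyMinimal] :
    Ram ((⟨0, -1, 1, 4, -4⟩ : WeierstrassCurve ℤ).baseChange ℚ) 5 :=
  ⟨3, inferInstance, by decide, mult_three_5835a1,
    by rw [padicValInt_three_minimalDiscriminant_5835a1]; decide⟩

/-- **Erratum hypothesis (iv) `E(ℚ₅)[5] = 0` for `5835a1`** — a THEOREM here: `5` is a prime of
NON-SPLIT multiplicative reduction (`LocalTorsion.localTorsion_eq_zero_of_nonsplit`).
[cite: SilvermanAEC2009, Thm VII.6.1 and Exercise 3.5] [cite: Castella2018Erratum, Thm. 1.1 (iv) (p. 1)] -/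
theorem localTorsion_five_5835a1 [((⟨0, -1, 1, 4, -4⟩ : WeierstrassCurve ℤ).baseChange ℚ).IsElliptic]
    [((⟨0, -1, 1, 4, -4⟩ : WeierstrassCurve ℤ).baseChange ℚ).IsGloballyMinimal] :
    ∀ P : ((((⟨0, -1, 1, 4, -4⟩ : WeierstrassCurve ℤ).baseChange ℚ)).baseChange ℚ_[5]).toAffine.Point, 5 • P = 0 → P = 0 :=
  LocalTorsion.localTorsion_eq_zero_of_nonsplit _ 5 (by norm_num) mult_five_5835a1 not_split_five_5835a1

/-- `#Ẽ(𝔽₇) = 4` for `5835a1` (`a₇ = 7 + 1 − 4 = 4`), kernel-decided on the `49` pairs of `𝔽₇²`.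
[cite: SilvermanAEC2009, V.2] -/
theorem card_F7_5835a1 :
    Nat.card (((⟨0, -1, 1, 4, -4⟩ : WeierstrassCurve ℤ).map (Int.castRingHom (ZMod 7))).toAffine.Point) = 4 := by
  rw [@natCard_point_eq_one_add_card (ZMod 7) (@ZMod.instField 7 ⟨by norm_num⟩) _ _ _ (by decide)]
  decide

/-- **`E[5]` irreducible for `5835a1`**: Frobenius no-root witness at the good prime `ℓ = 7`
(`a₇ = 4`, `X² − 4X + 7 ≡ X² + X + 2` root-free mod `5`; Mazur 1978 Prop. 6.3 (1)).
[cite: Mazur1978, §5 (p. 148) and §6 Prop. 6.3 (1) (p. 153)] -/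
theorem irr_five_5835a1 [((⟨0, -1, 1, 4, -4⟩ : WeierstrassCurve ℤ).baseChange ℚ).IsElliptic]
    [((⟨0, -1, 1, 4, -4⟩ : WeierstrassCurve ℤ).baseChange ℚ).IsGloballyMinimal] :
    Irr ((⟨0, -1, 1, 4, -4⟩ : WeierstrassCurve ℤ).baseChange ℚ) 5 :=
  haveI : Fact (Nat.Prime 7) := ⟨by norm_num⟩
  hasIrreducibleModPGaloisRep_of_intModel_of_noroot (integralModelInt_baseChange_int _) 5 7
    (by decide) (by rw [M5835a1_Δ]; decide) card_F7_5835a1 (by decide)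

/-- **`ρ̄_{E,5}` is onto for `5835a1`** — a THEOREM (irr(5) ∧ ram(5) ⟹ surj(5): a unipotent inertia
element at `3` + Serre 1972 Prop. 15; `surj_of_irr_of_ram`), so the open input at this pair is NOT
vacuous. [cite: Serre1972, §2.4 Prop. 15] [cite: SilvermanATAEC1994, V.4–V.5 and Exercise 5.13(b)] -/
theorem surj_five_5835a1 [((⟨0, -1, 1, 4, -4⟩ : WeierstrassCurve ℤ).baseChange ℚ).IsElliptic]
    [((⟨0, -1, 1, 4, -4⟩ : WeierstrassCurve ℤ).baseChange ℚ).IsGloballyMinimal] :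
    Surj ((⟨0, -1, 1, 4, -4⟩ : WeierstrassCurve ℤ).baseChange ℚ) 5 :=
  surj_of_irr_of_ram _ 5 irr_five_5835a1 ram_five_5835a1

/-! ## §3 The rung: the open input at `(5835a1, 5)` modulo H3♭ at this pair and published facts -/

/-- **BC5 RUNG of crux `OpenInputIMC` (item 19061) at the erratum-claimed (ram) pair `(5835a1, 5)`,
OUTSIDE every printed per-curve verification (`N = 5835 ≥ 5000`).** For `E = 5835a1`
(`N = 5835 = 3·5·389`, `r_an = 1` by Cremona's table — carried by the `ClassX11b` binder inside the
predicate, not provable in Lean today), `p = 5` (non-split multiplicative, `E[5]` irreducible,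
`ρ̄_{E,5}` onto — kernel theorems above) with the odd NON-split `E[5]`-ramified multiplicative witness
`q = 3` and (iv) `E(ℚ₅)[5] = 0` (kernel theorems above): (VN_p)
`castella2018Exceptional_bdpValueContinuity_trivialChar` + the eleven published ∕ two cited named facts
of the reduction + the JSW control fact + H3♭ AT THIS PAIR (`P2.IMCDivIntCoreFrameAtErratumData E 5`,
PREPRINT) ⟹ `P2OpenInputOnTreeAt E 5`. One line from imc-p1 g3's pair-level
`openInputOnTreeAt_of_oddNonsplitRam_of_localTorsion_of_core_of_castella2018Exceptional` (p437572).
No class-wide printed theorem gives `BSD(E,5)` here (`p ∥ N`: Castella 2018 Thm. A withdrawn at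
`p ∥ N`, its replacement is the erratum = preprint; JSW17 ∕ BCS24 need good ordinary `p`; W. Zhang 2014
needs `p ∤ N`; SZ14 is a preprint) and no per-curve verification reaches `N ≥ 5000`. CONDITIONAL on H3♭
at the pair and the named facts; closes no item; BSD is not proved by any of this.
[cite: Castella2018Erratum, Thm. 1.1, (2.4) (pp. 1, 4)]
[cite: Castella2018Exceptional, Thms. 2.10–2.11 (arXiv:1507.04260 pp. 13–14)]
[cite: JetchevSkinnerWan2017, Thm. 3.3.1 with §3.5 (3.5.c) (arXiv:1512.06894 pp. 11, 15)]
[cite: Wuthrich2014, Prop. 21 (p. 400)] [cite: Miller2011LMS, Thm. 1.2 and §1]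
[cite: Cremona1997, Table 1 (curve 5835a1)] -/
theorem openInputOnTreeAt_5835a1_5
    (hVN : castella2018Exceptional_bdpValueContinuity_trivialChar)
    (hGZ86 : GrossZagier1986_thm_I_7_3) (hGZK : rank_eq_analyticRank_of_analyticRank_le_one)
    (hWu : sha_dvd_analyticSha) (hSk : Skinner2016.thmC_padicValRat_bsd_rank_zero)
    (hnf : exists_isNewformOf) (hCST : CaiShuTian2014.thm11_trivialChar)
    (hFH : friedbergHoffstein_exists_twist_ne_zero_ramifiedAt)
    (hMaz : mazur_not_dvd_maninConstant_of_odd) (h331 : thm331_anticyclotomicControl_mult)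
    (hGZ : ∀ (N : ℕ) [NeZero N] (W : WeierstrassCurve ℚ) (K : Type) [Field K] [NumberField K],
      gross_zagier N W K)
    (hKo : ∀ (N : ℕ) [NeZero N] (W : WeierstrassCurve ℚ) (K : Type) [Field K] [NumberField K],
      kolyvagin N W K)
    (hPT : ∀ (K : Type) [Field K] [NumberField K], poitouTate_sum_localTatePairing_eq_zero K)
    (hEP : ∀ (K : Type) [Field K] [NumberField K] (v : HeightOneSpectrum (𝓞 K)),
      localEulerPoincareCharacteristic (v.adicCompletion K))
    [((⟨0, -1, 1, 4, -4⟩ : WeierstrassCurve ℤ).baseChange ℚ).IsElliptic]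
    [((⟨0, -1, 1, 4, -4⟩ : WeierstrassCurve ℤ).baseChange ℚ).IsGloballyMinimal]
    (h3 : P2.IMCDivIntCoreFrameAtErratumData ((⟨0, -1, 1, 4, -4⟩ : WeierstrassCurve ℤ).baseChange ℚ) 5) :
    P2OpenInputOnTreeAt ((⟨0, -1, 1, 4, -4⟩ : WeierstrassCurve ℤ).baseChange ℚ) 5 :=
  openInputOnTreeAt_of_oddNonsplitRam_of_localTorsion_of_core_of_castella2018Exceptional _ 5
    hVN hGZ86 hGZK hWu hSk hnf hCST hFH hMaz h331 hGZ hKo hPT hEP h3 (q := 3) (by decide)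
    (by decide) mult_three_5835a1 not_split_three_5835a1
    (by rw [padicValInt_three_minimalDiscriminant_5835a1]; decide) localTorsion_five_5835a1

/-! ## §4 The same rung over the route's ITEMS (by name) and in closed form -/

/-- **The rung over the route's items, by name.** (VN_p) `castella2018Exceptional_bdpValueContinuity_trivialChar`
(PUBLISHED; the by-name leaf `BDPValueContinuityInput` of plan D4) → `IMCDivAtErratumDataAll` (item
19270, H3♭-all — the ONE preprint input; only its instance at `(5835a1, 5)` is used) →
`PublishedInputsIMCReduction` (item 19283) → `WuthrichShaDividesAnalyticSha` (item 19285) →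
`thm331_anticyclotomicControl_mult` (JSW17 Thm. 3.3.1-mult, PUBLISHED) ⟹ `P2OpenInputOnTreeAt E 5`
for `E = 5835a1`. CONDITIONAL on those items; closes nothing. [cite: Castella2018Erratum, Thm. 1.1, (2.4) (pp. 1, 4)]
[cite: JetchevSkinnerWan2017, Thm. 3.3.1 with §3.5 (3.5.c) (arXiv:1512.06894 pp. 11, 15)]
[cite: Wuthrich2014, Prop. 21 (p. 400)] -/
theorem openInputOnTreeAt_5835a1_5_of_items
    (hVN : castella2018Exceptional_bdpValueContinuity_trivialChar)
    (h3 : ErratumRoadFive.IMCDivAtErratumDataAll) (hF : ErratumRoadFive.PublishedInputsIMCReduction)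
    (hWu : ErratumRoadFive.WuthrichShaDividesAnalyticSha) (h331 : thm331_anticyclotomicControl_mult)
    [((⟨0, -1, 1, 4, -4⟩ : WeierstrassCurve ℤ).baseChange ℚ).IsElliptic]
    [((⟨0, -1, 1, 4, -4⟩ : WeierstrassCurve ℤ).baseChange ℚ).IsGloballyMinimal] :
    P2OpenInputOnTreeAt ((⟨0, -1, 1, 4, -4⟩ : WeierstrassCurve ℤ).baseChange ℚ) 5 := by
  unfold ErratumRoadFive.IMCDivAtErratumDataAll at h3
  unfold ErratumRoadFive.WuthrichShaDividesAnalyticSha at hWu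
  obtain ⟨hGZ86, hGZK, hSk, hnf, hCST, hFH, hMaz, hGZ, hKo, -, -, hPTs, -, -, hEP, -⟩ := hF
  exact openInputOnTreeAt_5835a1_5 hVN hGZ86 hGZK hWu hSk hnf hCST hFH hMaz h331 hGZ hKo hPTs hEP (h3 _ 5)

/-- **Closed form** — the two instance facts INSTALLED (they are the theorems `isElliptic_5835a1`,
`isGloballyMinimal_5835a1` of §1), so that the statement displays no instance binder: (VN_p) + the
published ∕ cited facts + JSW control + H3♭ at `(5835a1, 5)` ⟹ the open input at `(5835a1, 5)`.
CONDITIONAL; closes nothing. [cite: Castella2018Erratum, Thm. 1.1, (2.4) (pp. 1, 4)]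
[cite: Castella2018Exceptional, Thms. 2.10–2.11 (arXiv:1507.04260 pp. 13–14)] -/
theorem openInputOnTreeAt_5835a1_5_closed
    (hVN : castella2018Exceptional_bdpValueContinuity_trivialChar)
    (hGZ86 : GrossZagier1986_thm_I_7_3) (hGZK : rank_eq_analyticRank_of_analyticRank_le_one)
    (hWu : sha_dvd_analyticSha) (hSk : Skinner2016.thmC_padicValRat_bsd_rank_zero)
    (hnf : exists_isNewformOf) (hCST : CaiShuTian2014.thm11_trivialChar)
    (hFH : friedbergHoffstein_exists_twist_ne_zero_ramifiedAt)
    (hMaz : mazur_not_dvd_maninConstant_of_odd) (h331 : thm331_anticyclotomicControl_mult)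
    (hGZ : ∀ (N : ℕ) [NeZero N] (W : WeierstrassCurve ℚ) (K : Type) [Field K] [NumberField K],
      gross_zagier N W K)
    (hKo : ∀ (N : ℕ) [NeZero N] (W : WeierstrassCurve ℚ) (K : Type) [Field K] [NumberField K],
      kolyvagin N W K)
    (hPT : ∀ (K : Type) [Field K] [NumberField K], poitouTate_sum_localTatePairing_eq_zero K)
    (hEP : ∀ (K : Type) [Field K] [NumberField K] (v : HeightOneSpectrum (𝓞 K)),
      localEulerPoincareCharacteristic (v.adicCompletion K))
    (h3 : @P2.IMCDivIntCoreFrameAtErratumData ((⟨0, -1, 1, 4, -4⟩ : WeierstrassCurve ℤ).baseChange ℚ)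
      isGloballyMinimal_5835a1 5 _) :
    @P2OpenInputOnTreeAt ((⟨0, -1, 1, 4, -4⟩ : WeierstrassCurve ℤ).baseChange ℚ)
      isElliptic_5835a1 isGloballyMinimal_5835a1 5 _ :=
  haveI := isElliptic_5835a1
  haveI := isGloballyMinimal_5835a1
  openInputOnTreeAt_5835a1_5 hVN hGZ86 hGZK hWu hSk hnf hCST hFH hMaz h331 hGZ hKo hPT hEP h3

end Summit.BirchSwinnertonDyer.BirchSwinnertonDyer.Theorems

end
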